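import Literature.NumberTheory.EllipticCurves.Kim2026.ShaLengthRankZeroLowerBound
import Literature.NumberTheory.EllipticCurves.PAdicHeights
import HarnessLib

/-!
# Kim 2026, Thm. 1.8 (6), analytic rank `0`, DEEP Kurihara certificate: the proof-covered twin
# WITH KIM'S OWN `t = 0` — split multiplicative at `p`, OR `E(ℚ_p)[p] = 0` (named fact; its bridges
# and its reading on the whole multiplicative locus are PROVED in the sibling `…Proofs` file)

Topic `NumberTheory/EllipticCurves`, sub-directory `Kim2026` (namespace = path,
`Literature.NumberTheory.EllipticCurves.Kim2026`). Sibling of `Kim2026/ShaLengthRankZeroLowerBound`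
(the literal fact `rankZero_le_padicValNat_sha_of_kuriharaNumber_ne_zero`, flag
`K26-(6)-shallow@t>0`, and its `(t0)` twin `…_of_localTorsionTrivial`), which stays byte-identical.
ONE named fact (`def … : Prop`, D-0014, statement-only, weaker than the literal fact hence weaker
than print) and nothing else; its three PROVED readings live in
`Kim2026/ShaLengthRankZeroLowerBoundMultiplicativeProofs`; no `_holds` (size XL, as every sibling). Written by the
literature typer of cell `bsd-print-x11a` (seat ty1, HOME `run/shared/lean/pub/bsd-print-x11a/`) on
the cell's TURNKEY T38 (lit g8, DOSSIER §38.3/§38.8): the two Kim-deep records `285660u1`,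
`285660u2` at `p = 5` (split `I₅` / `I₁₅`, `#E(ℚ₅)[5^∞] = 5`, certificate at depth `k = 2`) consume
the literal fact by name; this file gives the by-name proof-covered instrument for them — and for
every pair of the leaf `ClassX11a` (multiplicative at `p`).

## What Kim prints about `t` (C.-H. Kim, Amer. J. Math. 148 (2026) 79–129 = arXiv:2203.12159; held
text `paper:arxiv-2203.12159`, chunk files `pNNNN.txt` quoted with line numbers; read first-hand)

* §3.2.1 (p0015:L124–L131): "Following [rubin-book], fix a minimal Weierstrass model of `E` over
  `ℚ_p` … We write `t = 0` if `E` has SPLIT multiplicative reduction at `p`,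
  `t = length_{ℤ_p}(E(ℚ_p)[p^∞])` otherwise."
* p0017:L1–L3 (after Lemma 3.9): "It is remarkable that Lemma 3.9 does not involve `t`. When `E` has
  non-split multiplicative reduction at `p`, we have `t = 0`. When `E` has split multiplicative
  reduction at `p`, `#H⁰(ℚ_p, E[p^∞])` and `[E(ℚ_p) : E₀(ℚ_p)]` cancel each other. See [silverman2]."
* Lemma 3.9 (p0016:L128–L131): "If `E` has multiplicative reduction at `p ≥ 3`, then
  `exp*_{ω_E}(H¹(ℚ_p, T)) = p⁻¹ ℤ_p`."
* §3.4.1 (p0017:L111–L121) fixes `ι : #Ẽ_ns(𝔽_p) p^{−(1+t)} ℤ_p / (…) I_n ≅ ℤ_p/I_nℤ_p`, and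
  **Theorem 3.13** (p0017:L130–L135; journal Thm. 3.11): "`ι ∘ exp*_{ω_E} ∘ loc^s_p(κ^{Kato}_n) =
  u · p^t · δ̃_n ∈ ℤ_p/I_nℤ_p` where `u ∈ (ℤ_p/I_nℤ_p)ˣ`."
* §5.4.3 (p0024:L104–L119): "`j + length_{ℤ_p} Sel(ℚ, E[p^∞]) = ord_p(δ̃_1) + t = ∂^{(0)}(δ̃) + t`",
  "`j = ord_p(δ̃_{ℓ₁ℓ₂}) + t = ∂^{(2)}(δ̃) + t = ∂^{(∞)}(δ̃) + t`", with `j` the location of the Kato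
  Kolyvagin system (Prop. 2.8: `κ^{Kato}_n ∈ p^j Sel_{rel,n}` for every `n`); §1.5.1 (p0007:L72–L82):
  `∂^{(i)}(δ̃^{(k)}) = min {ord_p δ̃_n^{(k)} : n ∈ 𝒩_k, ν(n) = i}` (printed "min{j : … ∈ p^j … for
  every n}", i.e. the common divisibility exponent), `∂^{(i)}(δ̃) = lim_{k→∞} ∂^{(i)}(δ̃^{(k)})`.

So Kim's `t` VANISHES AT EVERY MULTIPLICATIVE PRIME `p ≥ 3`: at a split one by definition, at a
non-split one because `E(ℚ_p)[p] = 0` there (§3.1.2, p0015:L50; tree theorem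
`natCard_localPTorsion_eq_one_of_mult`). In the notation of the cell's flag (`t := ord_p #E(ℚ_p)[p^∞]`,
call it `t'` here) Kim's `t` is `0` at split multiplicative `p` and `t'` elsewhere; the two differ
exactly at a split multiplicative `p` with `E(ℚ_p)[p] ≠ 0` (e.g. `285660u1/u2` at `5`: `t' = 1`,
`t = 0`).

## Why the twin below is proof-covered at every depth `k ≥ 1` (the flag's own criterion)

The displayed argument sees a certificate `δ̃_n^{(k)} ≠ 0` (`n ∈ 𝒩_k`) only through
`x_n := ι ∘ exp* ∘ loc^s_p(κ^{Kato}_n) = u · p^t · δ̃_n ∈ ℤ/p^k` (Thm. 3.13), which is non-zero iff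
`ord_p δ̃_n^{(k)} + t < k`; when it is, `j ≤ ord x_n = ord_p δ̃_n^{(k)} + t` (Prop. 2.8: `p^j ∣ κ_n`,
hence `p^j ∣ x_n`) and `length Ш = ord_p δ̃_1 + t − j` (§5.4), so
`length Ш ≥ ord_p δ̃_1 − ord_p δ̃_n^{(k)} ≥ ord_p δ̃_1 − (k − 1)`. With `t = 0` the visibility
condition `ord_p δ̃_n^{(k)} < k` IS `δ̃_n^{(k)} ≠ 0`: every certificate at every depth is covered. This
is the sentence under which the `(t0)` twin was accepted (sibling file, "Under it `x_n = u · δ̃_n`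
exactly (Thm. 3.13) and the printed argument covers every depth `k ≥ 1`"); the present twin only
replaces "`E(ℚ_p)[p] = 0`" by Kim's printed case split "`E` split multiplicative at `p`, or
`E(ℚ_p)[p] = 0`" — i.e. by `t = 0` as Kim defines `t`.

READING NOTE (ty1, for the cell referee and the ARM P register; NOT part of any statement below). At a
split multiplicative `p` the printed Lemma 3.9 computes `exp*_{ω_{𝔾_m}}` on all of `H¹(ℚ_p, ℤ_p)`,
and p0017:L3's "cancel each other" is Prop. 3.1's criterion "`E(ℚ_p)[p] ≠ 0 ⟺ p ∣ ord_p(q)`"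
(p0015:L41–L48), whose `⇐` direction needs moreover `u_q ∈ (ℤ_pˣ)^p` (`q = p^v u_q`; tree theorem
`natCard_localPTorsion_eq_one_of_split_of_unitCongruence_fails`, kernel instance `320045bh1` at `5`:
`5 ∣ v₅(Δ) = 5` yet `#E(ℚ₅)[5] = 1`). The paper's own general formula (§3.2.3, display before
Thm. 3.7: image `= #Ẽ_ns(𝔽_p)·[E(ℚ_p):E₀(ℚ_p)] / (#H⁰(ℚ_p,E[p^∞])·p) · ℤ_p`, equivalently
`exp*_{ω}(H¹(ℚ_p,T)) · log_ω(E(ℚ_p)) = ℤ_p`) gives `exp*_{ω_E}(H¹(ℚ_p, T)) = p^{e−1} ℤ_p` with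
`e := v_p(c_p) − t' ≥ 0` (the same computation returns Lemma 3.4 at a good `p`), so that with the
true lattice `δ̃_n = p^e · u′ · x_n`: the Kurihara numbers are AT LEAST as divisible as the (rigid)
Kolyvagin images, never less. Hence, whichever way Lemma 3.9 is read at such `p`, a non-zero
`δ̃_n^{(k)}` is visible in `x_n^{(k)}` at every depth (`j ≤ ord x_n^{(k)} = ord δ̃_n^{(k)} − e`,
`length Ш = ord δ̃_1 − e − j ≥ ord δ̃_1 − ord δ̃_n^{(k)}`), and clause (6) of Thm. 1.9 is unaffected
(`e` cancels between `∂^{(0)}` and `∂^{(∞)}`). When `t' = v_p(c_p)` (e.g. `285660u1`: `v₅(Δ) = 5`,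
`t' = 1`; `285660u2`: `v₅(Δ) = 15`, `t' = 1`) `e = 0` and Lemma 3.9 holds on the nose.

## Contents

* `rankZero_le_padicValNat_sha_of_kuriharaNumber_ne_zero_of_splitMultiplicative_or_localTorsionTrivial`
  — the named fact: the literal statement with ONE extra binder after the surjectivity binder,
  `W.HasSplitMultiplicativeReductionAtPrime p ∨ Nat.card {Q : E(ℚ_p) // p • Q = 0} = 1`
  ("Kim's `t = 0`").
* PROVED in the sibling file `Kim2026/ShaLengthRankZeroLowerBoundMultiplicativeProofs` (theorems only):
  the bridge literal ⇒ twin (`…_of`, binder dropped: the twin is weaker than the literal fact), the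
  bridge twin ⇒ `(t0)` twin (`Or.inr`: the twin sits between the two landed `Prop`s), and the READING
  on the multiplicative locus `rankZero_le_padicValNat_sha_of_kuriharaNumber_ne_zero_of_multiplicative`
  (binder DISCHARGED by `W.HasMultiplicativeReductionAtPrime p`: split ⇒ left; non-split ⇒ right by
  `natCard_localPTorsion_eq_one_of_mult`, Silverman AEC VII.6.1 / Ex. 3.5) — the shape a `ClassX11a`
  door consumes: no local-torsion datum, no Tate certificate, at any depth `k`.

What is NOT typed, and why (numbers, not adjectives): the cell's T38 binder
"`#E(ℚ_p)[p^k] ∣ p^{k−1}`" (`t' ≤ k − 1`). For a UNIT certificate (`ord δ̃_n = 0`; facts B5–B8 and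
the depth-two twin of B7) `t' ≤ k − 1` is the visibility condition; for the DEEP certificate of this
file (`ord_p δ̃_n^{(k)} ≤ k − 1` only) it is not: at a good anomalous `p` with `t = t' = 1`, `k = 2`,
`ord_p δ̃_n^{(2)} = 1` one has `x_n = u · p · δ̃_n = 0 ∈ ℤ/p²`, and the displayed argument learns
nothing from that `n`. On the multiplicative locus the question does not arise (`t = 0`).

## References

* C.-H. Kim, Amer. J. Math. 148 (2026) 79–129 = arXiv:2203.12159: §1.5.1, Thm. 1.9 (= journal
  Thm. 1.8) (6), Prop. 2.8, §3.1.2, Prop. 3.1, Prop. 3.2, §3.2.1, §3.2.3, Lemma 3.4, Thm. 3.7,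
  Lemma 3.9, §3.3, §3.4.1, Thm. 3.13 (= journal Thm. 3.11), Lemma 3.14, §5.4.1–5.4.4.
  [Kim2022StructureSelmer]
* J. H. Silverman, *The Arithmetic of Elliptic Curves*, GTM 106 (2009): VII.3 Prop. 3.1, Thm. VII.6.1,
  Exercise 3.5 (the non-split discharge). [SilvermanAEC2009]
* B. Mazur, K. Rubin, *Kolyvagin systems*, Mem. AMS 799 (2004) (location `j`, rigidity of `κ_n`).
  [MazurRubin2004]
-/

noncomputable section

open scoped MatrixGroups ModularForm Classical

open WeierstrassCurve CongruenceSubgroup Literature.NumberTheory.EllipticCurves.ModularForms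

namespace Literature.NumberTheory.EllipticCurves.Kim2026

/-- **PROOF-COVERED TWIN of `rankZero_le_padicValNat_sha_of_kuriharaNumber_ne_zero` WITH KIM'S
`t = 0`** — C.-H. Kim, Amer. J. Math. 148 (2026), Thm. 1.8 (= arXiv:2203.12159 Thm. 1.9) (6),
analytic rank `0`, certificate `δ̃_n^{(k)} ≠ 0` at a cyclic level `n ∈ 𝒩_k`, LOWER bound
`ord_p(L(E,1)/Ω(W)) ≤ ord_p #Ш(E/ℚ)(p) + (k − 1)`: the literal statement (binders byte-identical, see
the sibling file `Kim2026/ShaLengthRankZeroLowerBound`) with ONE extra binder after the surjectivity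
binder,
`W.HasSplitMultiplicativeReductionAtPrime p ∨ Nat.card {Q : (W.baseChange ℚ_[p]).toAffine.Point // (p : ℕ) • Q = 0} = 1`
— exactly the condition `t = 0` for Kim's `t` (§3.2.1, PDF/TeX chunk p0015:L124–L131: "`t = 0` if `E`
has split multiplicative reduction at `p`, `length_{ℤ_p} E(ℚ_p)[p^∞]` otherwise"). Under `t = 0`
Thm. 3.13 reads `ι ∘ exp* ∘ loc^s_p(κ^{Kato}_n) = u · δ̃_n` with `u` a unit of `ℤ_p/I_n` at EVERY
`n ∈ 𝒩_1`, so a non-zero `δ̃_n^{(k)}` at any depth `k ≥ 1` bounds the location `j` of the Kato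
Kolyvagin system (`j ≤ ord_p δ̃_n^{(k)} ≤ k − 1`, Prop. 2.8) and §5.4's
`length Ш = ord_p δ̃_1 + t − j` gives the displayed inequality: the printed argument covers the whole
statement (module docstring: the case split, the visibility criterion `ord_p δ̃_n^{(k)} + t < k`, and a
reading note on Lemma 3.9 at split multiplicative `p`). The right disjunct alone is the landed `(t0)`
twin `…_of_localTorsionTrivial`; the left disjunct is what the `ClassX11a` records at a split
multiplicative `p` with `E(ℚ_p)[p] ≠ 0` need (`285660u1/u2` at `5`, depth `k = 2`). Weaker than the
literal fact (bridge `…_of`, sibling Proofs file), hence weaker than print; nothing asserted; no `_holds` (size XL).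
[cite: Kim2022StructureSelmer, Thm. 1.9 (6) (PDF p. 8), §1.2.2 (PDF p. 5), §1.4.1 and §1.4.3–1.4.4 (PDF p. 7), §1.5.1–1.5.2 (PDF pp. 7–8), §1.3.5 (PDF p. 6), §3.1.2 and Prop. 3.2, §3.2.1 (definition of t) (PDF p. 15), Lemma 3.9 (PDF p. 16), Thm. 3.13 (PDF p. 17), §5.4.3 (PDF p. 24)] -/
def rankZero_le_padicValNat_sha_of_kuriharaNumber_ne_zero_of_splitMultiplicative_or_localTorsionTrivial :
    Prop :=
  ∀ (W : WeierstrassCurve ℚ) [W.IsElliptic] [W.IsGloballyMinimal] (p : ℕ) [Fact p.Prime],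
    5 ≤ p → W.HasSurjectiveModNGaloisRep p →
    (W.HasSplitMultiplicativeReductionAtPrime p ∨
      Nat.card {Q : (W.baseChange ℚ_[p]).toAffine.Point // (p : ℕ) • Q = 0} = 1) →
    W.entireLFunction 1 ≠ 0 → Finite W.sha →
    ∀ {N : ℕ} [NeZero N] (D : ModularParametrizationData W N),
    ¬ (p : ℤ) ∣ D.maninConstant →
    (∃ u : ℚ, ‖(u : ℚ_[p])‖ = 1 ∧ W.realPeriodRat = u * plusPeriod D.f) →
    ∀ (k n : ℕ) [NeZero n], 1 ≤ k → Kato.IsKolyvaginProduct W p k n →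
    (∀ (ℓ : ℕ) [Fact ℓ.Prime], ℓ ∣ n →
      Nat.card {P : ((WeierstrassCurve.integralModelInt W).map
          (Int.castRingHom (ZMod ℓ))).toAffine.Point // p • P = 0} ≤ p) →
    ∀ ψ : (ℓ : ℕ) → (ZMod ℓ)ˣ →* Multiplicative (ZMod (p ^ k)),
      (∀ ℓ ∈ n.primeFactors, Function.Surjective (ψ ℓ)) →
      kuriharaNumber D.f (p ^ k) n ψ ≠ 0 →
    ∃ q : ℚ, W.entireLFunction 1 / (W.realPeriodRat : ℂ) = (q : ℂ) ∧
      padicValRat p q ≤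
        (padicValNat p (Nat.card (AddCommGroup.primaryComponent W.sha p)) : ℤ) + ((k - 1 : ℕ) : ℤ)

end Literature.NumberTheory.EllipticCurves.Kim2026

end
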